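import Literature.AlgebraicGeometry.Motives.MumfordTateGroupOfOrientationNondegenerateMaximal
import Literature.AlgebraicGeometry.Motives.MumfordTateGroupOfOrientationVersusHodgeGroup
import Literature.AlgebraicGeometry.Motives.CyclotomicFieldThirteenOrientation
import HarnessLib

/-!
# On `ℚ(ζ₁₃)`, weight `4`: `MT(V⁴_{(F,Λ)})(ℂ) < MT(V¹_{(F,Θ^G_Λ)})(ℂ) = L_F(ℂ)` and `Hg(V⁴_Λ)(ℂ) < Hg(V¹_Θ)(ℂ) = U_F(ℂ)` — Question (V.A.10)
# at the level of Mumford–Tate groups by MAXIMALITY of the nondegenerate G-type (no module computation)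

[topic AlgebraicGeometry/Motives]

Layer `Literature/AlgebraicGeometry/Motives`, lane `lit-hodgefound` (Track 2 foundations library; seat `lit-hodgefound-p02`, gen 27,
row g27-#13).  THEOREMS ONLY (no definition, no named fact; net debt `0`).  p02's g26-#11 `Motives/CyclotomicFieldThirteenOrientation`
exhibits on `F = ℚ(ζ₁₃)` an effective `4`-orientation `Λ` (`Λ^{2,2} = ∅`) with `𝓡(F,Λ) = 5` whose G-type `Θ` (`deg_Θ = [4 < 2·deg_Λ]`) is
STRONGLY NONDEGENERATE (`𝓡(F,Θ) = 7 = ½·12 + 1`).  g27-#12 `Motives/MumfordTateGroupOfOrientationNondegenerateMaximal`: a strongly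
nondegenerate oriented structure has the largest Mumford–Tate and Hodge groups on `F`; g27-#9: `MT ≤ MT ⟹ 𝓡 ≤ 𝓡`; g27-#10: `MT ≤ MT ⟺ Hg ≤ Hg`
(`F` CM, weights `≠ 0`).  Hence the strict inclusions, with no computation of the modules `W`.

THE PRINTS.  GGK [GreenGriffithsKerr2012] (V.A.10) p. 158 («is `𝓡(F,Π) ≥ 𝓡(F,Θ)`?»), (V.A.5) p. 157 (the `ℚ(ζ₁₃)` examples (iv)–(v), Kubota
rank `7`), (V.D.6) p. 165, (V.D.7) p. 165 («the SCMpHS `V³_{(ℚ(ζ₁₃),Π)}` arising from (v) is strongly nondegenerate»).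

WHAT IS PROVED (`[HodgeTensorFacts.{0,0}]`; `K13 = CyclotomicField 13 ℚ`).
* **`exists_orientation_mumfordTateGroupBaseChange_lt_weight_four`** — there are an effective `4`-orientation `Λ` of `ℚ(ζ₁₃)` with `Λ^{2,2} = ∅`
  and the `1`-orientation `Θ` of its G-type with `MT(V⁴_Λ)(ℂ) < MT(V¹_Θ)(ℂ)`, `Hg(V⁴_Λ)(ℂ) < Hg(V¹_Θ)(ℂ)` (STRICT), `dim M_φ̃(V⁴_Λ) = 5 < 7 =
  dim M_φ̃(V¹_Θ)`, and `MT(V_{Λ″})(ℂ) ≤ MT(V¹_Θ)(ℂ)` for EVERY orientation `Λ″` of `ℚ(ζ₁₃)` of every weight (maximality).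

HONEST SCOPE.  Existential statement (the orientations are g26-#11's transports of `p12`, `t12` along `galEquiv13`); point groups over `ℂ`
inside `GL(ℂ ⊗ ℚ(ζ₁₃))`; conditional on the tree's standing `HodgeTensorFacts`.

## References
* [GreenGriffithsKerr2012] M. Green, P. Griffiths, M. Kerr, *Mumford–Tate Groups and Domains: Their Geometry and Arithmetic*, Ann. of
  Math. Stud. 183 (2012): (V.A.10) p. 158, (V.A.5) p. 157, (V.D.5)–(V.D.7) pp. 164–165.
* [Deligne1982HodgeCycles] P. Deligne, *Hodge cycles on abelian varieties*, LNM 900 (1982), I Ex. 3.7 (c).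
-/

noncomputable section

open scoped TensorProduct Classical Pointwise
open Module NumberField

namespace Literature.AlgebraicGeometry.Motives

namespace HodgeStructure

namespace Orientation

namespace CyclotomicThirteen

open Literature.NumberTheory.ComplexMultiplication

/-- `ℚ(ζ₁₃)` is the `13`-th cyclotomic extension of `ℚ` (named term). [folklore] -/
private theorem isCyclotomicExtension_K13' : IsCyclotomicExtension {13} ℚ K13 := CyclotomicField.isCyclotomicExtension 13 ℚ

/-- `ℚ(ζ₁₃)/ℚ` is Galois. [folklore] -/
private theorem isGalois_K13' : IsGalois ℚ K13 :=
  haveI := isCyclotomicExtension_K13'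
  IsCyclotomicExtension.isGalois {13} ℚ K13

/-- `ℚ(ζ₁₃)` is a CM field. [folklore] -/
private theorem isCMField_K13' : IsCMField K13 :=
  @IsCyclotomicExtension.Rat.isCMField K13 _ _ {13} ⟨13, Set.mem_singleton 13, by norm_num⟩ isCyclotomicExtension_K13'

variable [HodgeTensorFacts.{0, 0}]

/-- **On `ℚ(ζ₁₃)`, weight `4`: `MT(V⁴_Λ)(ℂ) < MT(V¹_Θ)(ℂ)` and `Hg(V⁴_Λ)(ℂ) < Hg(V¹_Θ)(ℂ)` for an effective `4`-orientation `Λ` (`Λ^{2,2} = ∅`)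
and its G-type `Θ`**, the latter strongly nondegenerate and hence with the LARGEST Mumford–Tate group on `ℚ(ζ₁₃)` (`MT(V_{Λ″})(ℂ) ≤ MT(V¹_Θ)(ℂ)`
for every `Λ″`), `dim M_φ̃ = 5 < 7`. [cite: GreenGriffithsKerr2012, (V.A.10) p. 158 and (V.D.6) p. 165] [cite: Deligne1982HodgeCycles, I Example 3.7 (c)] -/
theorem exists_orientation_mumfordTateGroupBaseChange_lt_weight_four :
    ∃ (Λ : Orientation K13 4) (Θ : Orientation K13 1),
      (∀ θ, 0 ≤ Λ.deg θ ∧ Λ.deg θ ≤ 4 ∧ Λ.deg θ ≠ 2) ∧ (∀ θ, Θ.deg θ = if 4 < 2 * Λ.deg θ then 1 else 0) ∧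
        (ofOrientation Λ).mumfordTateGroupBaseChange ℂ < (ofOrientation Θ).mumfordTateGroupBaseChange ℂ ∧
          (ofOrientation Λ).hodgeGroupBaseChange ℂ < (ofOrientation Θ).hodgeGroupBaseChange ℂ ∧
            (ofOrientation Λ).mtRank = 5 ∧ (ofOrientation Θ).mtRank = 7 ∧
              ∀ {m : ℤ} (Λ'' : Orientation K13 m),
                (ofOrientation Λ'').mumfordTateGroupBaseChange ℂ ≤ (ofOrientation Θ).mumfordTateGroupBaseChange ℂ := by
  haveI := isGalois_K13'
  haveI := isCMField_K13'
  obtain ⟨ι⟩ : Nonempty (K13 →+* ℂ) := inferInstance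
  obtain ⟨Λ, Θ, heff, hdeg, h5, h7, hlt, hΘ, -⟩ := exists_orientation_kubotaRank_lt_weight_four ι
  have hle : (ofOrientation Λ).mumfordTateGroupBaseChange ℂ ≤ (ofOrientation Θ).mumfordTateGroupBaseChange ℂ :=
    mumfordTateGroupBaseChange_complex_ofOrientation_le_of_isStronglyNondegenerate Θ Λ (AlgHom.id ℚ K13) ι one_ne_zero hΘ
  have hnot : ¬ (ofOrientation Θ).mumfordTateGroupBaseChange ℂ ≤ (ofOrientation Λ).mumfordTateGroupBaseChange ℂ :=
    not_mumfordTateGroupBaseChange_complex_ofOrientation_le_of_kubotaRank_lt Λ Θ (AlgHom.id ℚ K13) ι hlt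
  refine ⟨Λ, Θ, heff, hdeg, hle.lt_of_ne fun h => hnot h.ge, ?_, ?_, ?_, fun Λ'' => ?_⟩
  · refine (hodgeGroupBaseChange_complex_ofOrientation_le_of_mumfordTateGroupBaseChange_le Θ Λ one_ne_zero (by norm_num) hle).lt_of_ne
      fun h => hnot ?_
    exact mumfordTateGroupBaseChange_complex_ofOrientation_le_of_hodgeGroupBaseChange_le Λ Θ (by norm_num) one_ne_zero h.ge
  · rw [mtRank_ofOrientation_eq_kubotaRank _ (AlgHom.id ℚ K13) ι, h5]
  · rw [mtRank_ofOrientation_eq_kubotaRank _ (AlgHom.id ℚ K13) ι, h7]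
  · exact mumfordTateGroupBaseChange_complex_ofOrientation_le_of_isStronglyNondegenerate Θ Λ'' (AlgHom.id ℚ K13) ι one_ne_zero hΘ

end CyclotomicThirteen

end Orientation

end HodgeStructure

end Literature.AlgebraicGeometry.Motives
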